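import Summits.NavierStokesRegularity.FunctionalMining.NoGo.PalinstrophySupRate
import HarnessLib

/-!
# Log door (a), K1-Q3: certificate reduction for `¬ PalinstrophyLogBudget C c`

Search for candidate a priori estimates; no regularity claim.

Cell `pub-nsfunc` (host summit NavierStokesRegularity, topic `FunctionalMining`), NO-GO branch, gen 4
(staged by the no-go seat `pub-nsfunc-nogo-g4`; file 1 of 3 of the kernel-checked instance of NO-GO #4:
`PalinstrophyLogCertificate` → `LogDoorW12` → `PalinstrophyLogKill`).

`PalinstrophyLogBudget C c` (`Candidates.lean`, census row K1-Q3 / log door (a)) asserts, along every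
classical solution of unforced Navier–Stokes on `T³`, `d𝒫/dt ≤ C ‖ω‖_∞ 𝒫 log(e + c𝒫/ν²)`, `𝒫 = ∫‖Δu‖²`.
`not_palinstrophyLogBudget_of_bounds`: ONE smooth divergence-free field `w` with `N(w) ≥ N₀`,
`𝒫(w) ≤ P₀`, `D₃(w) ≤ D₀`, `|ω_w|² ≤ M₀²` pointwise, together with ONE real inequality
`C M₀ P₀ log(e + c A² P₀) < 2N₀ − 2D₀/A` at some amplitude `A > 0`, refutes the budget (`C, c ≥ 0`):
the static door `PalinstrophyLogBudget.static` (tree, `NoGo/PalinstrophySupRate.lean`) at the datum `A • w`,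
`ν = 1`, the exact amplitude laws `N(A•w) = A³N`, `D₃(A•w) = A²D₃`, `𝒫(A•w) = A²𝒫`, `|ω_{A•w}|² = A²|ω_w|²`,
monotonicity of the right-hand side in `𝒫`, and division by `A³`. `PalinstrophyLogBudget.of_le`: the budget is
monotone in `C` and in `c`. The explicit field and the arithmetic are in `LogDoorW12.lean` / `PalinstrophyLogKill.lean`.
-/

noncomputable section

open Set MeasureTheory Real

namespace Summit.NavierStokesRegularity.FunctionalMining

open Literature.Analysis.FunctionSpaces Literature.Analysis.FluidPDE

variable {d : Type*} [Fintype d] [DecidableEq d]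

/-- **Certificate reduction for the log door (a).** One smooth divergence-free `w` with
`N(w) ≥ N₀`, `𝒫(w) ≤ P₀`, `D₃(w) ≤ D₀`, `|ω_w|² ≤ M₀²` pointwise, and an amplitude `A > 0` with
`C·M₀·P₀·log(e + c A² P₀) < 2N₀ − 2D₀/A` (`C, c ≥ 0`), refutes `PalinstrophyLogBudget C c`
(door `PalinstrophyLogBudget.static` at the datum `A • w`, `ν = 1`). Search for candidate a priori
estimates; no regularity claim. [ours] -/
theorem not_palinstrophyLogBudget_of_bounds (hd : Fintype.card d = 3) {C c : ℝ} (hC : 0 ≤ C)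
    (hc : 0 ≤ c) {w : UnitAddTorus d → EuclideanSpace ℝ d} (hw : Torus.IsSmooth w)
    (hdiv : Torus.IsDivFree w) {N₀ P₀ D₀ M₀ A : ℝ} (hM₀ : 0 ≤ M₀) (hA : 0 < A)
    (hN : N₀ ≤ palinstrophyProduction w) (hP : torusPalinstrophy w ≤ P₀)
    (hD : palinstrophyDissipation w ≤ D₀) (hω : ∀ x, torusVorticitySqAt w x ≤ M₀ ^ 2)
    (harith : C * M₀ * P₀ * Real.log (Real.exp 1 + c * (A ^ 2 * P₀)) < 2 * N₀ - 2 * D₀ / A) :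
    ¬ PalinstrophyLogBudget (d := d) C c := by
  intro h
  have hw1 : Torus.IsContDiff 1 w := hw.isContDiff (by exact_mod_cast le_top)
  have hsm : Torus.IsSmooth (A • w) := hw.smul A
  have hdf : Torus.IsDivFree (A • w) := isDivFree_const_smul hw1 hdiv A
  have hωA : ∀ x, torusVorticitySqAt (A • w) x ≤ (A * M₀) ^ 2 := fun x => by
    rw [torusVorticitySqAt_amplitude hw1 A x, mul_pow]
    exact mul_le_mul_of_nonneg_left (hω x) (sq_nonneg A)
  have hle := h.static hd one_pos hsm hdf (mul_nonneg hA.le hM₀) hωA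
  rw [palinstrophyProduction_amplitude hw, palinstrophyDissipation_amplitude hw,
    torusPalinstrophy_amplitude hw, one_pow, div_one] at hle
  have hP0 : 0 ≤ torusPalinstrophy w := torusPalinstrophy_nonneg w
  have hP₀ : 0 ≤ P₀ := hP0.trans hP
  have he1 : 1 ≤ Real.exp 1 := by linarith [Real.add_one_le_exp (1 : ℝ)]
  have hcA : 0 ≤ c * (A ^ 2 * torusPalinstrophy w) := mul_nonneg hc (mul_nonneg (sq_nonneg A) hP0)
  have hcA₀ : 0 ≤ c * (A ^ 2 * P₀) := mul_nonneg hc (mul_nonneg (sq_nonneg A) hP₀)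
  set L₀ := Real.log (Real.exp 1 + c * (A ^ 2 * P₀)) with hL₀
  have hL0 : 0 ≤ L₀ := Real.log_nonneg (by linarith)
  have hlogP : 0 ≤ Real.log (Real.exp 1 + c * (A ^ 2 * torusPalinstrophy w)) :=
    Real.log_nonneg (by linarith)
  have hlogle : Real.log (Real.exp 1 + c * (A ^ 2 * torusPalinstrophy w)) ≤ L₀ := by
    apply Real.log_le_log (by linarith)
    have : c * (A ^ 2 * torusPalinstrophy w) ≤ c * (A ^ 2 * P₀) :=
      mul_le_mul_of_nonneg_left (mul_le_mul_of_nonneg_left hP (sq_nonneg A)) hc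
    linarith
  have h1 : 0 ≤ C * (A * M₀) := mul_nonneg hC (mul_nonneg hA.le hM₀)
  have hrhs : C * (A * M₀) * (A ^ 2 * torusPalinstrophy w) *
      Real.log (Real.exp 1 + c * (A ^ 2 * torusPalinstrophy w)) ≤
      C * (A * M₀) * (A ^ 2 * P₀) * L₀ :=
    calc C * (A * M₀) * (A ^ 2 * torusPalinstrophy w) *
          Real.log (Real.exp 1 + c * (A ^ 2 * torusPalinstrophy w))
        ≤ C * (A * M₀) * (A ^ 2 * torusPalinstrophy w) * L₀ :=
          mul_le_mul_of_nonneg_left hlogle (mul_nonneg h1 (mul_nonneg (sq_nonneg A) hP0))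
      _ ≤ C * (A * M₀) * (A ^ 2 * P₀) * L₀ := by
          apply mul_le_mul_of_nonneg_right _ hL0
          exact mul_le_mul_of_nonneg_left (mul_le_mul_of_nonneg_left hP (sq_nonneg A)) h1
  have h3 : 0 < A ^ 3 := pow_pos hA 3
  have hA0 : A ≠ 0 := hA.ne'
  have key : 2 * palinstrophyProduction w - 2 * palinstrophyDissipation w / A ≤ C * M₀ * P₀ * L₀ := by
    have e1 : 2 * palinstrophyProduction w - 2 * palinstrophyDissipation w / A =
        (2 * (A ^ 3 * palinstrophyProduction w) - 2 * 1 * (A ^ 2 * palinstrophyDissipation w)) /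
          A ^ 3 := by
      field_simp
    have e2 : C * M₀ * P₀ * L₀ = (C * (A * M₀) * (A ^ 2 * P₀) * L₀) / A ^ 3 := by
      field_simp
    rw [e1, e2]
    exact div_le_div_of_nonneg_right (hle.trans hrhs) h3.le
  have hDA : 2 * palinstrophyDissipation w / A ≤ 2 * D₀ / A :=
    div_le_div_of_nonneg_right (by linarith) hA.le
  have hN2 : 2 * N₀ ≤ 2 * palinstrophyProduction w := by linarith
  exact absurd (lt_of_le_of_lt key harith) (by linarith)

/-- **Monotonicity of the log budget in its two constants**: for `C ≤ C'`, `0 ≤ C'`, `0 ≤ c ≤ c'`,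
`PalinstrophyLogBudget C c → PalinstrophyLogBudget C' c'` (the right-hand side
`C ‖ω‖_∞ 𝒫 log(e + c𝒫/ν²)` is monotone in `C` and `c`, all other factors being non-negative).
[folklore] -/
theorem PalinstrophyLogBudget.of_le {C C' c c' : ℝ}
    (h : PalinstrophyLogBudget (d := d) C c) (hC : C ≤ C') (hC' : 0 ≤ C') (hc0 : 0 ≤ c)
    (hc : c ≤ c') : PalinstrophyLogBudget (d := d) C' c' := by
  intro hd ν hν a b hab u p hu t ht M hM hω R hR
  have h1 := h hd hν hab hu t ht M hM hω R hR
  have hP : 0 ≤ torusPalinstrophy (u t) := torusPalinstrophy_nonneg (u t)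
  have he1 : 1 ≤ Real.exp 1 := by linarith [Real.add_one_le_exp (1 : ℝ)]
  have hx : 0 ≤ c * torusPalinstrophy (u t) / ν ^ 2 := by positivity
  have hxx : c * torusPalinstrophy (u t) / ν ^ 2 ≤ c' * torusPalinstrophy (u t) / ν ^ 2 :=
    div_le_div_of_nonneg_right (mul_le_mul_of_nonneg_right hc hP) (sq_nonneg ν)
  have hL0 : 0 ≤ Real.log (Real.exp 1 + c * torusPalinstrophy (u t) / ν ^ 2) :=
    Real.log_nonneg (by linarith)
  have hL : Real.log (Real.exp 1 + c * torusPalinstrophy (u t) / ν ^ 2) ≤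
      Real.log (Real.exp 1 + c' * torusPalinstrophy (u t) / ν ^ 2) :=
    Real.log_le_log (by linarith) (by linarith)
  calc R ≤ C * M * torusPalinstrophy (u t) *
        Real.log (Real.exp 1 + c * torusPalinstrophy (u t) / ν ^ 2) := h1
    _ ≤ C' * M * torusPalinstrophy (u t) *
        Real.log (Real.exp 1 + c * torusPalinstrophy (u t) / ν ^ 2) :=
      mul_le_mul_of_nonneg_right
        (mul_le_mul_of_nonneg_right (mul_le_mul_of_nonneg_right hC hM) hP) hL0
    _ ≤ C' * M * torusPalinstrophy (u t) *
        Real.log (Real.exp 1 + c' * torusPalinstrophy (u t) / ν ^ 2) :=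
      mul_le_mul_of_nonneg_left hL (mul_nonneg (mul_nonneg hC' hM) hP)

end Summit.NavierStokesRegularity.FunctionalMining

end
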